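import Summits.Ventures.HodgeRepro2.T5FinitePlaceTensorEquiv
import Summits.Ventures.HodgeRepro2.T5TraceBaseChange

/-!
# The local norm and trace `L_w → Kᵥ`; `E_w / F_v` is Galois with group `{1, c}` at a non-split place
(cell pub-hodge-repro2, seat p3)

Tier-5 N2 support, §N2.9.2 of route/T5-N2-route-3.md («completions») at the finite places, continued from files
115–117 (T5FinitePlaceLiesOver / Quadratic / TensorEquiv) with file 99 (T5TraceBaseChange). At a place `w ∣ v` with
`[L_w : Kᵥ] = [L : K]`: the norm and trace of the finite `Kᵥ`-algebra `L_w` restrict on `L` to the global norm and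
trace (`norm_algebraMap`, `trace_algebraMap` — the norm commutes with the completion). For the quadratic datum
`E = F(s)`, `s² = θ`, at a NON-SPLIT place (`θ` not a `v`-adic square) with `c : E ≃ₐ[F] E`, `c s = −s`:
`E_w / F_v` is GALOIS with group `{1, extendAut c}` (`isGalois`, `univ_eq_pair`), the local norm is
`N(y) = y · c(y)` (`algebraMap_norm_eq_mul_localConj`), `N(√θ) = −θ` (`norm_algebraMap_s`), every square of
`F_v` is a local norm (`isSquare_mem_range_norm`) — the vocabulary of row N2.7.1's «`F⁺_v^×/N(F_v^×)`» and of the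
determinant class `d₀ mod N(E_v^×)` (Shimura 2008 Lemma 1.6), without the printed fact `|F⁺_v^×/N| = 2`
(local class field theory — display-class, not here). Mathlib + files 99, 115–117 only.
No display; no device. §8(d): uses an L-value-free non-vanishing device: NO.
-/

namespace Summit.Ventures.HodgeRepro2.T5FinitePlaceLocalNorm

open IsDedekindDomain IsDedekindDomain.HeightOneSpectrum NumberField Module
open scoped Summit.Ventures.HodgeRepro2.T5FinitePlaceLiesOver TensorProduct
open Summit.Ventures.HodgeRepro2.T5FinitePlaceLiesOver Summit.Ventures.HodgeRepro2.T5FinitePlaceQuadratic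
  Summit.Ventures.HodgeRepro2.T5FinitePlaceTensorEquiv Summit.Ventures.HodgeRepro2.T5TraceBaseChange

section General

variable {K L : Type*} [Field K] [NumberField K] [Field L] [NumberField L] [Algebra K L]
variable (v : HeightOneSpectrum (𝓞 K)) (w : HeightOneSpectrum (𝓞 L)) [w.asIdeal.LiesOver v.asIdeal]

/-- **The local norm restricts to the global norm:** `N_{L_w/Kᵥ}(x) = N_{L/K}(x)` for `x ∈ L`, when
`[L_w : Kᵥ] = [L : K]` (through `tensorLiftEquiv` and file 99's `norm_one_tmul`). -/
theorem norm_algebraMap (h : finrank (v.adicCompletion K) (w.adicCompletion L) = finrank K L) (x : L) :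
    Algebra.norm (v.adicCompletion K) (algebraMap L (w.adicCompletion L) x) =
      algebraMap K (v.adicCompletion K) (Algebra.norm K x) := by
  rw [algebraMap_eq_tensorLiftEquiv_one_tmul v w h x, Algebra.norm_eq_of_algEquiv, norm_one_tmul]

/-- **The local trace restricts to the global trace** under the same hypothesis. -/
theorem trace_algebraMap (h : finrank (v.adicCompletion K) (w.adicCompletion L) = finrank K L) (x : L) :
    Algebra.trace (v.adicCompletion K) (w.adicCompletion L) (algebraMap L (w.adicCompletion L) x) =
      algebraMap K (v.adicCompletion K) (Algebra.trace K L x) := by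
  rw [algebraMap_eq_tensorLiftEquiv_one_tmul v w h x, Algebra.trace_eq_of_algEquiv, trace_one_tmul]

end General

section Quadratic

variable {F E : Type*} [Field F] [NumberField F] [Field E] [NumberField E] [Algebra F E]
  [Algebra.IsQuadraticExtension F E]
variable (v : HeightOneSpectrum (𝓞 F)) (w : HeightOneSpectrum (𝓞 E)) [w.asIdeal.LiesOver v.asIdeal]
variable {s : E} {θ : F}
variable (hs : s ^ 2 = algebraMap F E θ) (hspan : Submodule.span F {(1 : E), s} = ⊤)
  (hsq : ¬ IsSquare (algebraMap F (v.adicCompletion F) θ)) (c : E ≃ₐ[F] E) (hc : c s = -s)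

omit [Algebra.IsQuadraticExtension F E] [w.asIdeal.LiesOver v.asIdeal] in
include hs hsq in
/-- `θ ≠ 0` (a non-square), hence `s ≠ 0` and its image `S ∈ E_w` is non-zero. -/
theorem algebraMap_s_ne_zero : algebraMap E (w.adicCompletion E) s ≠ 0 := by
  intro h0
  have hs0 : s = 0 := (algebraMap E (w.adicCompletion E)).injective (by rw [h0, map_zero])
  apply hsq
  have h1 : algebraMap F E θ = 0 := by rw [← hs, hs0, zero_pow two_ne_zero]
  have hθ : θ = 0 := (algebraMap F E).injective (by rw [h1, map_zero])
  rw [hθ, map_zero]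
  exact ⟨0, by simp⟩

include hs hspan hsq hc in
/-- The local conjugation is not the identity: it moves `S` to `−S ≠ S`. -/
theorem extendAutOfNotIsSquare_ne_refl : extendAutOfNotIsSquare v w hs hspan hsq c ≠ AlgEquiv.refl := by
  intro h
  have h1 := extendAutOfNotIsSquare_apply_s v w hs hspan hsq c hc
  rw [h, AlgEquiv.coe_refl, id_eq, ← map_neg] at h1
  have h2 : s = -s := (algebraMap E (w.adicCompletion E)).injective h1
  have h3 : (2 : E) * s = 0 := by rw [two_mul, add_eq_zero_iff_eq_neg]; exact h2
  rcases mul_eq_zero.mp h3 with h4 | h4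
  · exact two_ne_zero h4
  · exact algebraMap_s_ne_zero v w hs hsq (by rw [h4, map_zero])

include hs hspan hsq hc in
/-- **`E_w / F_v` is Galois** at a non-split place: the automorphism group has exactly `2 = [E_w : F_v]`
elements (`1` and the local conjugation). -/
theorem isGalois : IsGalois (v.adicCompletion F) (w.adicCompletion E) := by
  refine IsGalois.of_card_aut_eq_finrank (v.adicCompletion F) (w.adicCompletion E) ?_
  rw [Nat.card_eq_fintype_card, (finrank_eq_two_iff_not_isSquare v w hs hspan).mpr hsq]
  refine le_antisymm ?_ ?_
  · have h1 := AlgEquiv.card_le (F := v.adicCompletion F) (K := w.adicCompletion E)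
    rwa [(finrank_eq_two_iff_not_isSquare v w hs hspan).mpr hsq] at h1
  · exact Fintype.one_lt_card_iff.mpr
      ⟨extendAutOfNotIsSquare v w hs hspan hsq c, AlgEquiv.refl,
        extendAutOfNotIsSquare_ne_refl v w hs hspan hsq c hc⟩

include hs hspan hsq hc in
open Classical in
/-- The automorphism group of `E_w / F_v` is `{1, c}`. -/
theorem univ_eq_pair :
    (Finset.univ : Finset (w.adicCompletion E ≃ₐ[v.adicCompletion F] w.adicCompletion E)) =
      {AlgEquiv.refl, extendAutOfNotIsSquare v w hs hspan hsq c} := by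
  symm
  apply Finset.eq_univ_of_card
  rw [Finset.card_pair (extendAutOfNotIsSquare_ne_refl v w hs hspan hsq c hc).symm]
  have h1 := AlgEquiv.card_le (F := v.adicCompletion F) (K := w.adicCompletion E)
  rw [(finrank_eq_two_iff_not_isSquare v w hs hspan).mpr hsq] at h1
  have h2 : 1 < Fintype.card (w.adicCompletion E ≃ₐ[v.adicCompletion F] w.adicCompletion E) :=
    Fintype.one_lt_card_iff.mpr
      ⟨extendAutOfNotIsSquare v w hs hspan hsq c, AlgEquiv.refl,
        extendAutOfNotIsSquare_ne_refl v w hs hspan hsq c hc⟩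
  omega

include hs hspan hsq hc in
/-- Every `F_v`-automorphism of `E_w` is `1` or the local conjugation. -/
theorem eq_refl_or_eq_localConj (σ : w.adicCompletion E ≃ₐ[v.adicCompletion F] w.adicCompletion E) :
    σ = AlgEquiv.refl ∨ σ = extendAutOfNotIsSquare v w hs hspan hsq c := by
  classical
  have h := Finset.mem_univ σ
  rw [univ_eq_pair v w hs hspan hsq c hc, Finset.mem_insert, Finset.mem_singleton] at h
  exact h

include hs hspan hsq hc in
open Classical in
/-- **The local norm is `y · c(y)`:** `N_{E_w/F_v}(y) = y · (extendAut c)(y)` in `E_w`. -/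
theorem algebraMap_norm_eq_mul_localConj (y : w.adicCompletion E) :
    algebraMap (v.adicCompletion F) (w.adicCompletion E) (Algebra.norm (v.adicCompletion F) y) =
      y * extendAutOfNotIsSquare v w hs hspan hsq c y := by
  haveI := isGalois v w hs hspan hsq c hc
  rw [Algebra.norm_eq_prod_automorphisms, univ_eq_pair v w hs hspan hsq c hc,
    Finset.prod_pair (extendAutOfNotIsSquare_ne_refl v w hs hspan hsq c hc).symm, AlgEquiv.coe_refl, id_eq]

include hs hspan hsq hc in
/-- **`N(√θ) = −θ`:** the local norm of the image of `s` is `−θ`. -/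
theorem norm_algebraMap_s :
    Algebra.norm (v.adicCompletion F) (algebraMap E (w.adicCompletion E) s) =
      -(algebraMap F (v.adicCompletion F) θ) := by
  apply (algebraMap (v.adicCompletion F) (w.adicCompletion E)).injective
  rw [algebraMap_norm_eq_mul_localConj v w hs hspan hsq c hc, extendAutOfNotIsSquare_apply_s v w hs hspan hsq c hc,
    mul_neg, ← sq, algebraMap_sq_eq v w hs, map_neg]

include hs hspan hsq in
/-- The local norm of `E_w / F_v` restricts to the global norm `N_{E/F}` on `E`. -/
theorem norm_algebraMap_of_not_isSquare (x : E) :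
    Algebra.norm (v.adicCompletion F) (algebraMap E (w.adicCompletion E) x) =
      algebraMap F (v.adicCompletion F) (Algebra.norm F x) :=
  norm_algebraMap v w (finrank_eq_of_not_isSquare v w hs hspan hsq) x

omit [Algebra.IsQuadraticExtension F E] in
include hs hspan hsq in
/-- Every square of `F_v` is a local norm: `N(a) = a²`. -/
theorem norm_algebraMap_left (a : v.adicCompletion F) :
    Algebra.norm (v.adicCompletion F) (algebraMap (v.adicCompletion F) (w.adicCompletion E) a) = a ^ 2 := by
  rw [Algebra.norm_algebraMap, (finrank_eq_two_iff_not_isSquare v w hs hspan).mpr hsq]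

omit [Algebra.IsQuadraticExtension F E] in
include hs hspan hsq in
/-- Squares of `F_v` lie in the image of the local norm. -/
theorem isSquare_mem_range_norm {a : v.adicCompletion F} (ha : IsSquare a) :
    a ∈ Set.range (Algebra.norm (v.adicCompletion F) : w.adicCompletion E →* v.adicCompletion F) := by
  obtain ⟨t, rfl⟩ := ha
  exact ⟨algebraMap _ _ t, by rw [norm_algebraMap_left v w hs hspan hsq, sq]⟩

include hs hspan hsq hc in
/-- `−θ` lies in the image of the local norm. -/
theorem neg_theta_mem_range_norm :
    -(algebraMap F (v.adicCompletion F) θ) ∈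
      Set.range (Algebra.norm (v.adicCompletion F) : w.adicCompletion E →* v.adicCompletion F) :=
  ⟨algebraMap E (w.adicCompletion E) s, by rw [norm_algebraMap_s v w hs hspan hsq c hc]⟩

end Quadratic

end Summit.Ventures.HodgeRepro2.T5FinitePlaceLocalNorm
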